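import Literature.NumberTheory.GaloisRepresentations.PstWeilDeligneCyclotomicWeight
import Literature.NumberTheory.GaloisRepresentations.PotentialDiagonalizabilityCriteriaProofs
import Literature.NumberTheory.PAdicHodge.HodgeTateCyclotomic
import HarnessLib

/-!
# From `ℚ_p(1)` to the clause "the cyclotomic character is de Rham of weight `-1`"

The clause (F2) `CyclotomicWeightNegOne` of a `p`-adic Hodge datum is phrased for the framed
rank-one representation `Γ_F → GL_1(ℚ̄_p)` through models over finite `E/ℚ_p`
(`FramedRep.IsDeRhamWithWeightsIn 𝔅 (-1) (-1) (cyclotomicPadicAlgCl F p)`), whereas period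
computations are done with the `ℚ_p`-linear character `ℚ_p(1)` (`cyclotomicRepQp F p`). This file
bridges the two for an ARBITRARY period-ring datum `𝔅`:

* `PeriodRingData.finrank_filD_eq_of_equiv`, `PeriodRingData.hodgeTateWeights_eq_of_equiv`:
  the Hodge filtration on `D_B`, hence the multiset of Hodge–Tate weights, is invariant under
  equivariant isomorphism of representations (complement to the accepted
  `PeriodRingData.isAdmissible_iff_of_equiv`);
* `cyclotomicBot F p`: the model of the cyclotomic character over `E = ⊥ = ℚ_p ⊆ ℚ̄_p`,
  `hasQlModel_cyclotomicPadicAlgCl`, and the equivariant isomorphism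
  `botLinearEquiv : (Fin 1 → ⊥) ≃ₗ[ℚ_p] ℚ_p` with `ℚ_p(1)` (`botLinearEquiv_restrictScalarsQl`);
* **`isDeRhamWithWeightsIn_cyclotomicPadicAlgCl`**: if `ℚ_p(1)` is `𝔅`-admissible with
  `𝔅.hodgeTateWeights (ℚ_p(1)) = {-1}` then the cyclotomic character is `𝔅`-de Rham with weights
  in `[-1, -1]`. With `𝔅 = B_HT` (accepted `HodgeTateCyclotomic`) this gives
  `isDeRhamWithWeightsIn_hodgeTate_cyclotomicPadicAlgCl`; with `𝔅 = B_dR` it is clause (F2).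

All [folklore] (Fontaine 1994, Exp. III §1.5: `D_B` is functorial and `ℚ_p`-linear).

## References
* [FontaineAsterisque223III] J.-M. Fontaine, Astérisque 223 (1994), Exp. III §1.5.
* [BuzzardGee2014] K. Buzzard, T. Gee (2014), §2.2.
-/

noncomputable section

open scoped TensorProduct MatrixGroups
open Field ValuativeRel

namespace Literature.NumberTheory.GaloisRepresentations

namespace PeriodRingData

/-! ### Hodge–Tate weights are invariant under isomorphism -/

section Equiv

universe u v v' w w'

variable {Γ : Type u} [Group Γ] [TopologicalSpace Γ] {P : Type v} {E : Type v'} [Field P]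
  [TopologicalSpace P] [Field E] [Algebra P E]
  (𝔅 : PeriodRingData.{u, v, v', w} Γ P E)
  {M₁ : Type w'} [AddCommGroup M₁] [Module P M₁] [TopologicalSpace M₁]
  {M₂ : Type w'} [AddCommGroup M₂] [Module P M₂] [TopologicalSpace M₂]
  (ρ₁ : ContinuousRep Γ P M₁) (ρ₂ : ContinuousRep Γ P M₂)

omit [TopologicalSpace Γ] [TopologicalSpace P] [TopologicalSpace M₁] [TopologicalSpace M₂] in
/-- `1 ⊗ f` maps `Fil^i B ⊗ M₁` into `Fil^i B ⊗ M₂`. [folklore] -/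
theorem algebraTensorModule_map_mem_filTensor (f : M₁ →ₗ[P] M₂) (i : ℤ) {x : 𝔅.B ⊗[P] M₁}
    (hx : x ∈ 𝔅.filTensor M₁ i) :
    TensorProduct.AlgebraTensorModule.map (LinearMap.id : 𝔅.B →ₗ[E] 𝔅.B) f x ∈ 𝔅.filTensor M₂ i := by
  obtain ⟨y, rfl⟩ := hx
  refine ⟨TensorProduct.AlgebraTensorModule.map (LinearMap.id : 𝔅.fil i →ₗ[E] 𝔅.fil i) f y, ?_⟩
  rw [← LinearMap.comp_apply, ← TensorProduct.AlgebraTensorModule.map_comp, ← LinearMap.comp_apply,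
    ← TensorProduct.AlgebraTensorModule.map_comp, LinearMap.id_comp, LinearMap.comp_id,
    LinearMap.id_comp, LinearMap.comp_id]

/-- **The Hodge filtration on `D_B` is invariant under isomorphism**: an equivariant `P`-linear
isomorphism `V₁ ≃ V₂` induces `Fil^i D_B(V₁) ≃ Fil^i D_B(V₂)`. [cite: FontaineAsterisque223III, Exp. III §1.5] -/
theorem finrank_filD_eq_of_equiv (e : M₁ ≃ₗ[P] M₂) (he : ∀ (σ : Γ) (x : M₁), e (ρ₁ σ x) = ρ₂ σ (e x))
    (i : ℤ) : Module.finrank E (𝔅.filD ρ₁ i) = Module.finrank E (𝔅.filD ρ₂ i) := by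
  have he' : ∀ (σ : Γ) (y : M₂), e.symm (ρ₂ σ y) = ρ₁ σ (e.symm y) := fun σ y => by
    apply e.injective
    rw [he, e.apply_symm_apply, e.apply_symm_apply]
  obtain ⟨F, hF⟩ := 𝔅.exists_DMap ρ₁ ρ₂ e.toLinearMap he
  obtain ⟨G, hG⟩ := 𝔅.exists_DMap ρ₂ ρ₁ e.symm.toLinearMap he'
  have hGF : ∀ x, G (F x) = x := fun x => by
    apply Subtype.ext
    rw [hG, hF, ← LinearMap.comp_apply, ← TensorProduct.AlgebraTensorModule.map_comp]
    have : (e.symm.toLinearMap ∘ₗ e.toLinearMap) = LinearMap.id := by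
      ext; simp
    rw [this, LinearMap.comp_id, TensorProduct.AlgebraTensorModule.map_id, LinearMap.id_apply]
  have hFG : ∀ y, F (G y) = y := fun y => by
    apply Subtype.ext
    rw [hF, hG, ← LinearMap.comp_apply, ← TensorProduct.AlgebraTensorModule.map_comp]
    have : (e.toLinearMap ∘ₗ e.symm.toLinearMap) = LinearMap.id := by
      ext; simp
    rw [this, LinearMap.comp_id, TensorProduct.AlgebraTensorModule.map_id, LinearMap.id_apply]
  have hFfil : ∀ x ∈ 𝔅.filD ρ₁ i, F x ∈ 𝔅.filD ρ₂ i := fun x hx => by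
    rw [mem_filD_iff, hF]
    exact 𝔅.algebraTensorModule_map_mem_filTensor e.toLinearMap i hx
  have hGfil : ∀ y ∈ 𝔅.filD ρ₂ i, G y ∈ 𝔅.filD ρ₁ i := fun y hy => by
    rw [mem_filD_iff, hG]
    exact 𝔅.algebraTensorModule_map_mem_filTensor e.symm.toLinearMap i hy
  exact LinearEquiv.finrank_eq
    { toFun := fun x => ⟨F x, hFfil x x.2⟩
      map_add' := fun x y => Subtype.ext (by simp)
      map_smul' := fun c x => Subtype.ext (by simp)
      invFun := fun y => ⟨G y, hGfil y y.2⟩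
      left_inv := fun x => Subtype.ext (hGF x)
      right_inv := fun y => Subtype.ext (hFG y) }

/-- **Hodge–Tate weights are invariant under isomorphism of representations.** [cite: FontaineAsterisque223III, Exp. III §1.5] -/
theorem hodgeTateWeights_eq_of_equiv (e : M₁ ≃ₗ[P] M₂) (he : ∀ (σ : Γ) (x : M₁), e (ρ₁ σ x) = ρ₂ σ (e x)) :
    𝔅.hodgeTateWeights ρ₁ = 𝔅.hodgeTateWeights ρ₂ := by
  rw [hodgeTateWeights_eq_jumpMultiset, hodgeTateWeights_eq_jumpMultiset]
  congr 1
  funext i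
  exact 𝔅.finrank_filD_eq_of_equiv ρ₁ ρ₂ e he i

end Equiv

end PeriodRingData

end Literature.NumberTheory.GaloisRepresentations

namespace Literature.NumberTheory.PAdicHodge

open Literature.NumberTheory.GaloisRepresentations

/-! ### The model of the cyclotomic character over `E = ℚ_p ⊆ ℚ̄_p` -/

section Bot

variable (F : Type) [Field F] (p : ℕ) [Fact p.Prime]

/-- `ℚ_p → (⊥ : IntermediateField ℚ_p ℚ̄_p)` is continuous. [folklore] -/
theorem continuous_algebraMap_bot :
    Continuous (algebraMap ℚ_[p] (⊥ : IntermediateField ℚ_[p] (PadicAlgCl p))) :=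
  continuous_induced_rng.2 (continuous_algebraMap_padicAlgCl p)

/-- The ring homomorphism `ℤ_p → ℚ_p → (⊥ : IntermediateField ℚ_p ℚ̄_p)`. [folklore] -/
def padicIntToBot : ℤ_[p] →+* (⊥ : IntermediateField ℚ_[p] (PadicAlgCl p)) :=
  (algebraMap ℚ_[p] (⊥ : IntermediateField ℚ_[p] (PadicAlgCl p))).comp PadicInt.Coe.ringHom

/-- Unfolding of `padicIntToBot`. [folklore] -/
@[simp] theorem padicIntToBot_apply (x : ℤ_[p]) :
    padicIntToBot p x = algebraMap ℚ_[p] (⊥ : IntermediateField ℚ_[p] (PadicAlgCl p)) (x : ℚ_[p]) := rfl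

/-- `ℤ_p → ⊥` is continuous. [folklore] -/
theorem continuous_padicIntToBot : Continuous (padicIntToBot p) :=
  (continuous_algebraMap_bot p).comp (continuous_subtype_val : Continuous ((↑) : ℤ_[p] → ℚ_[p]))

/-- **The cyclotomic character over `E = ℚ_p ⊆ ℚ̄_p`**: `Γ_F →ₜ* GL_1(⊥)`, base change of the
accepted `FramedGaloisRep.cyclotomic F p : Γ_F →ₜ* GL_1(ℤ_p)`. [folklore] -/
def cyclotomicBot : FramedRep (absoluteGaloisGroup F) (⊥ : IntermediateField ℚ_[p] (PadicAlgCl p)) 1 :=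
  FramedRep.baseChange (padicIntToBot p) (continuous_padicIntToBot p) (FramedGaloisRep.cyclotomic F p)

/-- Entries of `cyclotomicBot`. [folklore] -/
@[simp] theorem cyclotomicBot_apply_coe (σ : absoluteGaloisGroup F) (i j : Fin 1) :
    ((cyclotomicBot F p σ : GL (Fin 1) (⊥ : IntermediateField ℚ_[p] (PadicAlgCl p))) :
        Matrix (Fin 1) (Fin 1) (⊥ : IntermediateField ℚ_[p] (PadicAlgCl p))) i j =
      algebraMap ℚ_[p] (⊥ : IntermediateField ℚ_[p] (PadicAlgCl p))
        (((GaloisRep.cyclotomicCharacter F p σ : ℤ_[p]ˣ) : ℤ_[p]) : ℚ_[p]) := by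
  simp [cyclotomicBot, FramedGaloisRep.cyclotomic]

/-- **`cyclotomicBot` is a `ℚ_p`-model of `Γ_F → GL_1(ℚ̄_p)`** (`HasQlModel` with `P = 1`). [folklore] -/
theorem hasQlModel_cyclotomicPadicAlgCl :
    Literature.NumberTheory.Automorphic.HasQlModel (FramedGaloisRep.cyclotomicPadicAlgCl F p)
      (⊥ : IntermediateField ℚ_[p] (PadicAlgCl p)) (cyclotomicBot F p) := by
  refine ⟨1, ContinuousMonoidHom.ext fun σ => Units.ext (Matrix.ext fun i j => ?_)⟩
  rw [FramedRep.conj_apply, inv_one, mul_one, one_mul, FramedRep.baseChange_apply]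
  simp [FramedGaloisRep.cyclotomicPadicAlgCl_apply_coe]

/-- The `ℚ_p`-linear isomorphism `(Fin 1 → ⊥) ≃ ℚ_p`. [folklore] -/
def botLinearEquiv : (Fin 1 → (⊥ : IntermediateField ℚ_[p] (PadicAlgCl p))) ≃ₗ[ℚ_[p]] ℚ_[p] :=
  (LinearEquiv.funUnique (Fin 1) ℚ_[p] (⊥ : IntermediateField ℚ_[p] (PadicAlgCl p))).trans
    (IntermediateField.botEquiv ℚ_[p] (PadicAlgCl p)).toLinearEquiv

/-- Unfolding of `botLinearEquiv`. [folklore] -/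
theorem botLinearEquiv_apply (x : Fin 1 → (⊥ : IntermediateField ℚ_[p] (PadicAlgCl p))) :
    botLinearEquiv p x = IntermediateField.botEquiv ℚ_[p] (PadicAlgCl p) (x default) := rfl

/-- **The `ℚ_p`-linear representation underlying `cyclotomicBot` is isomorphic to `ℚ_p(1)`**
(equivariance of `botLinearEquiv`). [folklore] -/
theorem botLinearEquiv_restrictScalarsQl (σ : absoluteGaloisGroup F)
    (x : Fin 1 → (⊥ : IntermediateField ℚ_[p] (PadicAlgCl p))) :
    botLinearEquiv p (Literature.NumberTheory.Automorphic.restrictScalarsQl _ (cyclotomicBot F p) σ x) =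
      cyclotomicRepQp F p σ (botLinearEquiv p x) := by
  rw [botLinearEquiv_apply, botLinearEquiv_apply, cyclotomicRepQp_apply,
    Literature.NumberTheory.Automorphic.restrictScalarsQl_apply_apply,
    FramedRep.toContinuousRep_apply_apply, Matrix.mulVec, dotProduct, Fintype.sum_unique,
    cyclotomicBot_apply_coe, map_mul, IntermediateField.botEquiv_def]

end Bot

/-! ### The clause from the `ℚ_p`-linear computation -/

section Clause

variable {F : Type} [Field F] {p : ℕ} [Fact p.Prime] [Algebra ℚ_[p] F]

/-- `⊥ ⊆ ℚ̄_p` is finite over `ℚ_p`. [folklore] -/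
theorem finiteDimensional_bot_padicAlgCl :
    FiniteDimensional ℚ_[p] (⊥ : IntermediateField ℚ_[p] (PadicAlgCl p)) :=
  Module.finite_of_finrank_eq_succ IntermediateField.finrank_bot

/-- **If `ℚ_p(1)` is `𝔅`-admissible with Hodge–Tate weights `{-1}`, then the cyclotomic character
`Γ_F → GL_1(ℚ̄_p)` is `𝔅`-de Rham with weights in `[-1, -1]`** (for any period-ring datum `𝔅`).
[cite: FontaineAsterisque223III, Exp. III §1.5] [cite: BuzzardGee2014, §2.2] -/
theorem isDeRhamWithWeightsIn_cyclotomicPadicAlgCl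
    (𝔅 : PeriodRingData.{0, 0, 0, 0} (absoluteGaloisGroup F) ℚ_[p] F)
    (hadm : 𝔅.IsAdmissible (cyclotomicRepQp F p))
    (hw : 𝔅.hodgeTateWeights (cyclotomicRepQp F p) = {-1}) :
    FramedRep.IsDeRhamWithWeightsIn 𝔅 (-1) (-1) (FramedGaloisRep.cyclotomicPadicAlgCl F p) := by
  refine ⟨⊥, finiteDimensional_bot_padicAlgCl, cyclotomicBot F p, hasQlModel_cyclotomicPadicAlgCl F p, ?_, ?_⟩
  · exact (𝔅.isAdmissible_iff_of_equiv _ _ (botLinearEquiv p) (botLinearEquiv_restrictScalarsQl F p)).2 hadm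
  · intro w hw'
    rw [𝔅.hodgeTateWeights_eq_of_equiv _ _ (botLinearEquiv p) (botLinearEquiv_restrictScalarsQl F p), hw,
      Multiset.mem_singleton] at hw'
    subst hw'
    exact ⟨le_rfl, le_rfl⟩

end Clause

/-! ### Instance: `B_HT` -/

section HodgeTate

variable {F : Type} [Field F] [ValuativeRel F] [TopologicalSpace F] [IsNonarchimedeanLocalField F]
  [CharZero F] {p : ℕ} [Fact p.Prime] (hp : valuation F p < 1)

/-- **The cyclotomic character is `B_HT`-"de Rham" (Hodge–Tate) with weights in `[-1, -1]`** for
the canonical `ℚ_p`-structure (accepted `isAdmissible_hodgeTate_cyclotomicRepQp`,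
`hodgeTateWeights_cyclotomicRepQp`). [cite: FontaineOuyang2022, §5.1] -/
theorem isDeRhamWithWeightsIn_hodgeTate_cyclotomicPadicAlgCl :
    letI := LocalField.padicAlgebra F p hp
    FramedRep.IsDeRhamWithWeightsIn (hodgeTatePeriodRingData hp) (-1) (-1)
      (FramedGaloisRep.cyclotomicPadicAlgCl F p) := by
  letI := LocalField.padicAlgebra F p hp
  exact isDeRhamWithWeightsIn_cyclotomicPadicAlgCl _ (isAdmissible_hodgeTate_cyclotomicRepQp hp)
    (hodgeTateWeights_cyclotomicRepQp hp)

end HodgeTate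

end Literature.NumberTheory.PAdicHodge

end
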